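import Summits.HubbardSuperconductivity.HubbardSuperconductivity.Theorems.ThermalWedgeTwSeededEnsembleEquivalenceOfDifferentiablePressure
import Summits.HubbardSuperconductivity.HubbardSuperconductivity.Theorems.ThermalWedgeTwSeededEnsembleEquivalenceRSharpSectorEntropy

/-!
# Crux `TwSeededEnsembleEquivalenceR` (stmt-HubbardSuperconductivity-15581), line `cold-floor-collapse`
# (slug `Sketch`), lead c5 — the SHARP thermal closer (true sector entropy `2h((1−δ)/2)` for `log 4`)

Support file (`--supports stmt-HubbardSuperconductivity-15581`; sorry-free; no definition; route-file free).

The tree's thermal closer `stub_thermalCloser` (CHERNOFF + WALK, …ThermalCloser.lean) concludes the crux instance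
`e_L + p_L(β, μ₀) − μ₀ n_L ≤ log 4/β + ε` from the two-sided secant bracket of the seeded pressure at `μ₀`; the only lossy
step is the probabilistic normal form (d) with the whole Fock entropy `L² log 4`. Re-running the SAME proof with the
sharp normal form (d♯) `hw_sharpDefectNormalForm` (…RSharpSectorEntropy.lean: sector dimension `C(2L², N_L)`) gives

* `thermalCloser_sharp` — bracket at `μ₀` ⟹ `e_L + p_L(β, μ₀) − μ₀ n_L ≤ log C(2L², N_L)/(βL²) + ε` eventually;
* `cruxInstanceSharp_of_bracket`, `cruxInstanceSharp_of_differentiablePressure` — the analogues of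
  `bdl_cruxInstance_of_bracket` / `bdl_cruxInstance_of_differentiablePressure` with right-hand side
  `2 h((1−δ)/2)/β + ε` (`h = Real.binEntropy`), i.e. the crux instance with the ENTROPY SLACK
  `c_δ/β = (log 4 − 2h((1−δ)/2))/β > 0` to spare (`entropySlack_pos`).

The slack is what the HOT-WINDOW theorem (…RHotWindow.lean) spends on the repulsion `U`. Registered form:
`hw_cruxInstanceSharp_of_differentiablePressure`. [folklore: Bratteli–Robinson II §5.3 (large deviations of `N`)]
-/

set_option linter.dupNamespace false

namespace Summit.HubbardSuperconductivity.HubbardSuperconductivity.Theorems.TwSeededEnsembleEquivalenceR.HotWindow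

open Matrix Finset Literature.MathematicalPhysics.QuantumLattice
open Summit.HubbardSuperconductivity.HubbardSuperconductivity.Theorems.TwSeededEnsembleEquivalence.ThermalDuality
open Summit.HubbardSuperconductivity.HubbardSuperconductivity.Theorems.TwSeededEnsembleEquivalence.ExposedDensity
open scoped ComplexOrder Matrix.Norms.L2Operator

noncomputable section

/-- Division bookkeeping of the sharp closer: from `β(E − μN) + log Z ≤ S + R` and `R ≤ βVε` to
`E/V + log Z/(βV) − μN/V ≤ S/(βV) + ε`. [folklore] -/
theorem closer_divide_sharp {β V E N μ lZ S R ε : ℝ} (hβ : 0 < β) (hV : 0 < V)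
    (h : β * (E - μ * N) + lZ ≤ S + R) (hR : R ≤ β * V * ε) :
    E / V + lZ / (β * V) - μ * N / V ≤ S / (β * V) + ε := by
  have hβV : 0 < β * V := mul_pos hβ hV
  have key : β * (E - μ * N) + lZ ≤ S + β * V * ε := h.trans (by linarith)
  have h1 : E / V + lZ / (β * V) - μ * N / V = (β * (E - μ * N) + lZ) / (β * V) := by
    field_simp
    ring
  have h2 : S / (β * V) + ε = (S + β * V * ε) / (β * V) := by
    field_simp
  rw [h1, h2]
  exact div_le_div_of_nonneg_right key hβV.le

/-- **THE SHARP THERMAL CLOSER.** Fix `δ ∈ [1/10, 2/5]`, `U`, `g ≥ 0`, `β ≥ 1`, `μ₀`, and assume the TWO-SIDED SECANT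
BRACKET of the finite-volume seeded pressure `p_L(β, ·)` at `μ₀` (for every `η > 0` a step `τ > 0` with
`(p_L(μ₀+τ) − p_L(μ₀))/τ ≤ (1−δ) + η` and `(1−δ) − η ≤ (p_L(μ₀) − p_L(μ₀−τ))/τ` eventually in `L`). Then
`e_L + p_L(β,μ₀) − μ₀ n_L ≤ log C(2L², N_L)/(βL²) + ε` eventually in `L`, `N_L = 2⌊(1−δ)L²/2⌋`.
Proof = `stub_thermalCloser` verbatim (sector-weight basics (a)–(c) `stub_sectorWeightBasics`, walk
`bdl_thermalWalk_of_stubs`, `chernoffWalk_core`, `closer_rhs_le`) with (d♯) `hw_sharpDefectNormalForm` and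
`closer_divide_sharp` in the last line. [folklore] -/
theorem thermalCloser_sharp (δ U g β μ₀ : ℝ) (hδ : δ ∈ Set.Icc (1/10 : ℝ) (2/5 : ℝ)) (hβ : 1 ≤ β)
    (hg : 0 ≤ g)
    (hBr : ∀ η : ℝ, 0 < η → ∃ τ : ℝ, 0 < τ ∧ ∃ L₀ : ℕ, ∀ (L : ℕ) [NeZero L], L₀ ≤ L →
        ((Real.log (Matrix.partitionFn β (hubbardTorusWith 2 L 1 U (μ₀ + τ) - ((g / (L : ℝ) ^ 2 : ℝ) : ℂ) •
            ((pairField dWaveFormFactor L)ᴴ * pairField dWaveFormFactor L))).re / (β * (L : ℝ) ^ 2)) -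
          (Real.log (Matrix.partitionFn β (hubbardTorusWith 2 L 1 U μ₀ - ((g / (L : ℝ) ^ 2 : ℝ) : ℂ) •
            ((pairField dWaveFormFactor L)ᴴ * pairField dWaveFormFactor L))).re / (β * (L : ℝ) ^ 2))) / τ ≤
          (1 - δ) + η ∧
        (1 - δ) - η ≤
        ((Real.log (Matrix.partitionFn β (hubbardTorusWith 2 L 1 U μ₀ - ((g / (L : ℝ) ^ 2 : ℝ) : ℂ) •
            ((pairField dWaveFormFactor L)ᴴ * pairField dWaveFormFactor L))).re / (β * (L : ℝ) ^ 2)) -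
          (Real.log (Matrix.partitionFn β (hubbardTorusWith 2 L 1 U (μ₀ - τ) - ((g / (L : ℝ) ^ 2 : ℝ) : ℂ) •
            ((pairField dWaveFormFactor L)ᴴ * pairField dWaveFormFactor L))).re / (β * (L : ℝ) ^ 2))) / τ) :
    ∀ ε : ℝ, 0 < ε → ∃ L₀ : ℕ, ∀ (L : ℕ) [NeZero L], L₀ ≤ L →
      (((hubbardTorus 2 L 1 U - ((g / (L : ℝ) ^ 2 : ℝ) : ℂ) •
          ((pairField dWaveFormFactor L)ᴴ * pairField dWaveFormFactor L))).minEnergyOn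
            (@szSector (FermionTorus 2 L) _ _ (2 * ⌊(1 - δ) * (L : ℝ) ^ 2 / 2⌋₊) 0) / (L : ℝ) ^ 2) +
        (Real.log (Matrix.partitionFn β (hubbardTorusWith 2 L 1 U μ₀ - ((g / (L : ℝ) ^ 2 : ℝ) : ℂ) •
          ((pairField dWaveFormFactor L)ᴴ * pairField dWaveFormFactor L))).re / (β * (L : ℝ) ^ 2)) -
        μ₀ * ((2 * ⌊(1 - δ) * (L : ℝ) ^ 2 / 2⌋₊) : ℝ) / (L : ℝ) ^ 2 ≤
        Real.log ((2 * L ^ 2).choose (2 * ⌊(1 - δ) * (L : ℝ) ^ 2 / 2⌋₊)) / (β * (L : ℝ) ^ 2) + ε := by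
  intro ε hε
  have hβ0 : 0 < β := by linarith
  -- the walk constant
  obtain ⟨C, hC, hW⟩ := bdl_thermalWalk_of_stubs U g β hg hβ0.le
  -- the constants
  have hlog5 : 0 ≤ Real.log 5 := Real.log_nonneg (by norm_num)
  have hℓ₁ : 0 ≤ Real.log 5 + |μ₀| + 2 * C := by positivity
  obtain ⟨η, hη, hη', hηε⟩ : ∃ η : ℝ, 0 < η ∧ η ≤ 1 / 20 ∧ 2 * η * (Real.log 5 + |μ₀| + 2 * C) ≤ ε / 2 := by
    have hden : 0 < 4 * (Real.log 5 + |μ₀| + 2 * C) + 1 := by positivity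
    refine ⟨min (1 / 20) (ε / (4 * (Real.log 5 + |μ₀| + 2 * C) + 1)), lt_min (by norm_num) (div_pos hε hden),
      min_le_left _ _, ?_⟩
    refine closer_arith_eta (le_min (by norm_num) (div_pos hε hden).le) ?_
    exact (le_div_iff₀ hden).mp (min_le_right _ _)
  obtain ⟨τ, hτ, L₁, hbr⟩ := hBr η hη
  clear hBr
  refine ⟨max (max L₁ 20) (max ⌈2 / (τ * η)⌉₊ ⌈2 * (5 + 2 * (Real.log 5 + |μ₀| + 2 * C)) / ε⌉₊), ?_⟩
  intro L _ hL
  have hL₁ : L₁ ≤ L := le_trans (le_trans (le_max_left _ _) (le_max_left _ _)) hL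
  have hL20 : 20 ≤ L := le_trans (le_trans (le_max_right _ _) (le_max_left _ _)) hL
  have hLa : ⌈2 / (τ * η)⌉₊ ≤ L := le_trans (le_trans (le_max_left _ _) (le_max_right _ _)) hL
  have hLb : ⌈2 * (5 + 2 * (Real.log 5 + |μ₀| + 2 * C)) / ε⌉₊ ≤ L :=
    le_trans (le_trans (le_max_right _ _) (le_max_right _ _)) hL
  have hL' : (20 : ℝ) ≤ L := by exact_mod_cast hL20
  have hL1 : (1 : ℝ) ≤ L := by linarith
  have hLV : (L : ℝ) ≤ (L : ℝ) ^ 2 := by nlinarith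
  have hVpos : 0 < (L : ℝ) ^ 2 := by positivity
  have hβV : 0 < β * (L : ℝ) ^ 2 := by positivity
  have hLτη : 2 / (τ * η) ≤ (L : ℝ) ^ 2 := le_trans ((Nat.le_ceil _).trans (by exact_mod_cast hLa)) hLV
  have hLε : 2 * (5 + 2 * (Real.log 5 + |μ₀| + 2 * C)) / ε ≤ L := (Nat.le_ceil _).trans (by exact_mod_cast hLb)
  have hRHS := closer_rhs_le hβ hL1 hC hη.le hηε (closer_arith_L hL1 hℓ₁ hε hLε)
  -- the data at this L: sector-weight basics (a)–(c), the walk, the bracket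
  obtain ⟨hZsum, htilt, hpos, -⟩ := stub_sectorWeightBasics L U g β hβ0
  have hWL := hW L
  obtain ⟨hbU, hbD⟩ := hbr L hL₁
  clear hbr
  have hsecU := secant_rearrange_up hτ hβV hbU
  have hsecD := secant_rearrange_dn hτ hβV hbD
  clear hbU hbD
  -- the core estimate on the sector weights `W(N; μ)` and the partition function `Z(μ)` of this `L`
  have hcore := chernoffWalk_core
    (W := fun N μ => ∑ s ∈ (Finset.univ.filter fun s : Finset (Orb (FermionTorus 2 L)) => s.card = N),
      (Matrix.gibbsWeight β (hubbardTorusWith 2 L 1 U μ - ((g / (L : ℝ) ^ 2 : ℝ) : ℂ) •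
        ((pairField dWaveFormFactor L)ᴴ * pairField dWaveFormFactor L)) s s).re)
    (Z := fun μ => (Matrix.partitionFn β (hubbardTorusWith 2 L 1 U μ - ((g / (L : ℝ) ^ 2 : ℝ) : ℂ) •
      ((pairField dWaveFormFactor L)ᴴ * pairField dWaveFormFactor L))).re)
    L hL20 hβ hC hτ hη hη' hδ hZsum htilt hpos
    (fun n hnlo hn1 hnM => walk_ratio_down hβ0.le hC htilt (hpos μ₀ (n - 1) (by omega)) ((hWL n).1 hn1 hnM)
      hn1 hnlo)
    (fun n hnhi hnM => walk_ratio_up hβ0.le hC htilt (hpos μ₀ (n + 1) hnM) ((hWL n).2 hnM) hnhi (by nlinarith))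
    hsecU hsecD hLτη
  clear hZsum htilt hpos hWL hsecU hsecD
  -- the SHARP normal form at N_L
  have hn : ⌊(1 - δ) * (L : ℝ) ^ 2 / 2⌋₊ ≤ L ^ 2 := by
    have hδ0 : 0 ≤ 1 - δ := by linarith [hδ.2]
    have h1 : (1 - δ) * (L : ℝ) ^ 2 / 2 ≤ ((L ^ 2 : ℕ) : ℝ) := by
      push_cast
      have : 0 ≤ (1 - δ) * (L : ℝ) ^ 2 := mul_nonneg hδ0 hVpos.le
      have h0 : (1 - δ) * (L : ℝ) ^ 2 ≤ 1 * (L : ℝ) ^ 2 :=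
        mul_le_mul_of_nonneg_right (by linarith [hδ.1]) hVpos.le
      linarith
    exact (Nat.floor_le_floor h1).trans_eq (Nat.floor_natCast _)
  have hnf' := hw_sharpDefectNormalForm L U g β μ₀ _ hβ0 hn
  rw [Nat.cast_mul, Nat.cast_ofNat] at hnf'
  exact closer_divide_sharp hβ0 hVpos (hnf'.trans (add_le_add le_rfl hcore)) hRHS

/-- **The sharp crux instance from the secant bracket**: at `(δ, U, g, β, μ₀)` with `δ` in the window, `β ≥ 1`,
`g ≥ 0`, the bracket gives `e_L + p_L(β,μ₀) − μ₀ n_L ≤ 2h((1−δ)/2)/β + ε` for every `ε > 0`, eventually in `L`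
(`thermalCloser_sharp` + `log_choose_sector_le`). [folklore] -/
theorem cruxInstanceSharp_of_bracket (δ U g β μ₀ : ℝ) (hδ : δ ∈ Set.Icc (1/10 : ℝ) (2/5 : ℝ)) (hβ : 1 ≤ β)
    (hg : 0 ≤ g)
    (hbr : (∀ η : ℝ, 0 < η → ∃ τ : ℝ, 0 < τ ∧ ∃ L₀ : ℕ, ∀ (L : ℕ) [NeZero L], L₀ ≤ L →
        ((Real.log (Matrix.partitionFn β (hubbardTorusWith 2 L 1 U (μ₀ + τ) - ((g / (L : ℝ) ^ 2 : ℝ) : ℂ) • ((pairField dWaveFormFactor L)ᴴ * pairField dWaveFormFactor L))).re / (β * (L : ℝ) ^ 2)) -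
          (Real.log (Matrix.partitionFn β (hubbardTorusWith 2 L 1 U μ₀ - ((g / (L : ℝ) ^ 2 : ℝ) : ℂ) • ((pairField dWaveFormFactor L)ᴴ * pairField dWaveFormFactor L))).re / (β * (L : ℝ) ^ 2))) / τ ≤ (1 - δ) + η ∧
        (1 - δ) - η ≤ ((Real.log (Matrix.partitionFn β (hubbardTorusWith 2 L 1 U μ₀ - ((g / (L : ℝ) ^ 2 : ℝ) : ℂ) • ((pairField dWaveFormFactor L)ᴴ * pairField dWaveFormFactor L))).re / (β * (L : ℝ) ^ 2)) -
          (Real.log (Matrix.partitionFn β (hubbardTorusWith 2 L 1 U (μ₀ - τ) - ((g / (L : ℝ) ^ 2 : ℝ) : ℂ) • ((pairField dWaveFormFactor L)ᴴ * pairField dWaveFormFactor L))).re / (β * (L : ℝ) ^ 2))) / τ)) :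
    ∀ ε : ℝ, 0 < ε → ∃ L₀ : ℕ, ∀ (L : ℕ) [NeZero L], L₀ ≤ L →
      ((hubbardTorus 2 L 1 U - ((g / (L : ℝ) ^ 2 : ℝ) : ℂ) • ((pairField dWaveFormFactor L)ᴴ * pairField dWaveFormFactor L)).minEnergyOn (szSector (Λ := FermionTorus 2 L) (2 * ⌊(1 - δ) * (L : ℝ) ^ 2 / 2⌋₊) 0) / (L : ℝ) ^ 2) + (Real.log (Matrix.partitionFn β (hubbardTorusWith 2 L 1 U μ₀ - ((g / (L : ℝ) ^ 2 : ℝ) : ℂ) • ((pairField dWaveFormFactor L)ᴴ * pairField dWaveFormFactor L))).re / (β * (L : ℝ) ^ 2)) - μ₀ * ((2 * ⌊(1 - δ) * (L : ℝ) ^ 2 / 2⌋₊) : ℝ) / (L : ℝ) ^ 2 ≤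
        2 * Real.binEntropy ((1 - δ) / 2) / β + ε := by
  intro ε hε
  have hβ0 : 0 < β := lt_of_lt_of_le one_pos hβ
  obtain ⟨L₀, hL₀⟩ := thermalCloser_sharp δ U g β μ₀ hδ hβ hg hbr ε hε
  refine ⟨L₀, fun L _ hL => (hL₀ L hL).trans (add_le_add ?_ le_rfl)⟩
  have hVpos : 0 < (L : ℝ) ^ 2 := by
    have : (0 : ℝ) < L := by exact_mod_cast Nat.pos_of_ne_zero (NeZero.ne L)
    positivity
  have hent := log_choose_sector_le L (δ := δ) (by linarith [hδ.1]) (by linarith [hδ.2])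
  rw [div_le_div_iff₀ (mul_pos hβ0 hVpos) hβ0]
  calc Real.log ((2 * L ^ 2).choose (2 * ⌊(1 - δ) * (L : ℝ) ^ 2 / 2⌋₊)) * β
      ≤ 2 * (L : ℝ) ^ 2 * Real.binEntropy ((1 - δ) / 2) * β := mul_le_mul_of_nonneg_right hent hβ0.le
    _ = 2 * Real.binEntropy ((1 - δ) / 2) * (β * (L : ℝ) ^ 2) := by ring

/-- **The sharp crux instance from (TDL) + (DIFF) + (EDGE)** of the infinite-volume seeded pressure at
`(δ, U, g, β)`: some `L`-independent `μ₀ ∈ [μ₁, μ₂]` carries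
`e_L + p_L(β,μ₀) − μ₀ n_L ≤ 2h((1−δ)/2)/β + ε` for every `ε > 0`, eventually in `L`. Valid for EVERY real `U`
(in particular `U = 0`) and every `β ≥ 1`. [folklore] -/
theorem cruxInstanceSharp_of_differentiablePressure (δ U g β μ₁ μ₂ : ℝ)
    (hδ : δ ∈ Set.Icc (1/10 : ℝ) (2/5 : ℝ)) (hβ : 1 ≤ β) (hg : 0 ≤ g)
    (hP : ∃ (b : ℝ → ℝ) (μm μp : ℝ),
          (∀ μ ∈ Set.Icc μ₁ μ₂, ∀ κ : ℝ, 0 < κ → ∃ L₀ : ℕ, ∀ (L : ℕ) [NeZero L], L₀ ≤ L →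
            |Real.log (Matrix.partitionFn β (hubbardTorusWith 2 L 1 U μ - ((g / (L : ℝ) ^ 2 : ℝ) : ℂ) • ((pairField dWaveFormFactor L)ᴴ * pairField dWaveFormFactor L))).re / (β * (L : ℝ) ^ 2) - b μ| ≤ κ) ∧
          (∀ μ ∈ Set.Ioo μ₁ μ₂, DifferentiableAt ℝ b μ) ∧ μm ∈ Set.Ioo μ₁ μ₂ ∧ μp ∈ Set.Ioo μ₁ μ₂ ∧
          deriv b μm ≤ 1 - δ ∧ 1 - δ ≤ deriv b μp) :
    ∃ μ₀ ∈ Set.Icc μ₁ μ₂, ∀ ε : ℝ, 0 < ε → ∃ L₀ : ℕ, ∀ (L : ℕ) [NeZero L], L₀ ≤ L →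
      ((hubbardTorus 2 L 1 U - ((g / (L : ℝ) ^ 2 : ℝ) : ℂ) • ((pairField dWaveFormFactor L)ᴴ * pairField dWaveFormFactor L)).minEnergyOn (szSector (Λ := FermionTorus 2 L) (2 * ⌊(1 - δ) * (L : ℝ) ^ 2 / 2⌋₊) 0) / (L : ℝ) ^ 2) + (Real.log (Matrix.partitionFn β (hubbardTorusWith 2 L 1 U μ₀ - ((g / (L : ℝ) ^ 2 : ℝ) : ℂ) • ((pairField dWaveFormFactor L)ᴴ * pairField dWaveFormFactor L))).re / (β * (L : ℝ) ^ 2)) - μ₀ * ((2 * ⌊(1 - δ) * (L : ℝ) ^ 2 / 2⌋₊) : ℝ) / (L : ℝ) ^ 2 ≤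
        2 * Real.binEntropy ((1 - δ) / 2) / β + ε := by
  obtain ⟨b, μm, μp, hlim, hdiff, hm, hp, hdm, hdp⟩ := hP
  obtain ⟨μ₀, hμ₀, -, -, hbr⟩ :=
    tw_seededSecantBracket_of_differentiableLimit δ U g β μ₁ μ₂ μm μp b hlim hdiff hm hp hdm hdp
  exact ⟨μ₀, hμ₀, cruxInstanceSharp_of_bracket δ U g β μ₀ hδ hβ hg hbr⟩

/-! ### Registered form -/

/-- **Registered stub `hw_cruxInstanceSharp_of_differentiablePressure` (line `Sketch`, crux
stmt-HubbardSuperconductivity-15581): the sharp crux instance from (TDL)+(DIFF)+(EDGE), binder-free and fully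
qualified** (= `cruxInstanceSharp_of_differentiablePressure`). [folklore] -/
theorem hw_cruxInstanceSharp_of_differentiablePressure : ∀ (δ U g β μ₁ μ₂ : ℝ), δ ∈ Set.Icc (1/10 : ℝ) (2/5 : ℝ) → 1 ≤ β → 0 ≤ g → (∃ (b : ℝ → ℝ) (μm μp : ℝ), (∀ μ ∈ Set.Icc μ₁ μ₂, ∀ κ : ℝ, 0 < κ → ∃ L₀ : ℕ, ∀ (L : ℕ) [NeZero L], L₀ ≤ L → |Real.log (Matrix.partitionFn β (Literature.MathematicalPhysics.QuantumLattice.hubbardTorusWith 2 L 1 U μ - ((g / (L : ℝ) ^ 2 : ℝ) : ℂ) • ((Literature.MathematicalPhysics.QuantumLattice.pairField Literature.MathematicalPhysics.QuantumLattice.dWaveFormFactor L)ᴴ * Literature.MathematicalPhysics.QuantumLattice.pairField Literature.MathematicalPhysics.QuantumLattice.dWaveFormFactor L))).re / (β * (L : ℝ) ^ 2) - b μ| ≤ κ) ∧ (∀ μ ∈ Set.Ioo μ₁ μ₂, DifferentiableAt ℝ b μ) ∧ μm ∈ Set.Ioo μ₁ μ₂ ∧ μp ∈ Set.Ioo μ₁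 μ₂ ∧ deriv b μm ≤ 1 - δ ∧ 1 - δ ≤ deriv b μp) → ∃ μ₀ ∈ Set.Icc μ₁ μ₂, ∀ ε : ℝ, 0 < ε → ∃ L₀ : ℕ, ∀ (L : ℕ) [NeZero L], L₀ ≤ L → ((Literature.MathematicalPhysics.QuantumLattice.hubbardTorus 2 L 1 U - ((g / (L : ℝ) ^ 2 : ℝ) : ℂ) • ((Literature.MathematicalPhysics.QuantumLattice.pairField Literature.MathematicalPhysics.QuantumLattice.dWaveFormFactor L)ᴴ * Literature.MathematicalPhysics.QuantumLattice.pairField Literature.MathematicalPhysics.QuantumLattice.dWaveFormFactor L)).minEnergyOn (Literature.MathematicalPhysics.QuantumLattice.szSector (Λ := Literature.MathematicalPhysics.QuantumLattice.FermionTorus 2 L) (2 * ⌊(1 - δ) * (L : ℝ) ^ 2 / 2⌋₊) 0) / (L : ℝ) ^ 2) + (Real.log (Matrix.partitionFn β (Literature.MathematicalPhysics.QuantumLattice.hubbardTorusWith 2 L 1 U μ₀ - ((g / (L : ℝ) ^ 2 : ℝ) : ℂ) • ((Literature.MathematicalPhysics.QuantumLattice.pairField Literature.MathematicalPhysics.QuantumLattice.dWaveFormFactor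 L)ᴴ * Literature.MathematicalPhysics.QuantumLattice.pairField Literature.MathematicalPhysics.QuantumLattice.dWaveFormFactor L))).re / (β * (L : ℝ) ^ 2)) - μ₀ * ((2 * ⌊(1 - δ) * (L : ℝ) ^ 2 / 2⌋₊) : ℝ) / (L : ℝ) ^ 2 ≤ 2 * Real.binEntropy ((1 - δ) / 2) / β + ε :=
  fun δ U g β μ₁ μ₂ hδ hβ hg hP => cruxInstanceSharp_of_differentiablePressure δ U g β μ₁ μ₂ hδ hβ hg hP

end

end Summit.HubbardSuperconductivity.HubbardSuperconductivity.Theorems.TwSeededEnsembleEquivalenceR.HotWindow
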